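import Summits.Ventures.CertifiedArithmetic.LowPrec.GemmBinary16Step
import Summits.Ventures.CertifiedArithmetic.LowPrec.GemmThetaCertificate

/-!
# Round-to-nearest-even on the quarter grid for an arbitrary precision, in integers

HONEST FRAMING (venture CertifiedArithmetic / cell `pub-lowprec`, seat gemm, gen 12): certified error
envelopes and provably optimal rounding/accumulation schemes for low-precision formats under stated
cost models; every table by two implementations; no hardware or vendor claims.

Infrastructure for paper `gemm.tex` §Regimes, Theorem "the terminal constant of FP4 products for every
accumulator precision" (t:thetap): the θ-certificates proved so far (`GemmThetaE2M1*.lean`) are for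
ONE accumulator format each (`bfloat16`, `binary16`), through format-specific bridges
(`toRat_roundNE_BFloat16_quarter`, `toRat_roundNE_Binary16_grid`).  This file gives the bridge for an
ARBITRARY format `φ` whose exponent range contains the quarter grid (`qexp φ ≤ -2`): `rneZ m K` is
round-to-nearest-even of the integer `K` to `m + 1` significant bits (sign kept; the magnitude part is
`rneSigMag` of `GemmBinary16Step.lean`), `toRat_roundNE_quarter_prec` proves
`fl_φ(K/4) = rneZ (manBits φ) K / 4` whenever `|K|/4 ≤ maxRat φ` (closed form
`Format.rneGrid_of_pattern`, exactness of `(m+1)`-bit integers), and `rneSigMag_of_binade` /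
`rneShiftNat_of_decomp` spell the rounding out on a decomposition `n = q · 2^e + r` — the only
rounding facts the all-precision certificate `GemmThetaLaw*.lean` uses.  Dictionary for the one-step
map of `GemmThetaCertificate.lean`: `flStep_quarter_prec`, `gainOf_quarter_prec`,
`deficitOf_quarter_prec`.  Nothing here is specific to gemm.
-/

namespace Literature.ComputerArithmetic.FloatingPoint

namespace MiniFloat

open Format

/-! ### Integer RNE to `m + 1` significant bits, signed -/

/-- `rneZ m K`: round-to-nearest-even of the integer `K` to `m + 1` significant bits, sign kept, no
saturation (`toRat_roundNE_quarter_prec`). [cite: IEEE7542019, §4.3.1] -/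
def rneZ (m : ℕ) (K : ℤ) : ℤ :=
  if K < 0 then -((rneSigMag m K.natAbs : ℕ) : ℤ) else ((rneSigMag m K.natAbs : ℕ) : ℤ)

/-- `0` rounds to `0`. [folklore] -/
theorem rneSigMag_zero (m : ℕ) : rneSigMag m 0 = 0 := by
  unfold rneSigMag; simp

/-- RNE is odd: `rneZ (-K) = - rneZ K`. [folklore] -/
theorem rneZ_neg (m : ℕ) (K : ℤ) : rneZ m (-K) = -rneZ m K := by
  unfold rneZ
  rw [Int.natAbs_neg]
  rcases lt_trichotomy K 0 with h | h | h
  · rw [if_neg (by omega), if_pos h]; ring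
  · subst h; simp [rneSigMag_zero]
  · rw [if_pos (by omega), if_neg (by omega)]

/-- THE BINADE FORMULA: for `2^(m+e) ≤ n < 2^(m+e+1)`, `rneSigMag m n = rneShiftNat n e · 2^e`
(round `n / 2^e` to the nearest integer, ties to even, and scale back). [cite: IEEE7542019, §4.3.1] -/
theorem rneSigMag_of_binade {m n e : ℕ} (hlo : 2 ^ (m + e) ≤ n) (hhi : n < 2 ^ (m + e + 1)) :
    rneSigMag m n = rneShiftNat n e * 2 ^ e := by
  unfold rneSigMag
  rcases Nat.eq_zero_or_pos e with rfl | he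
  · rw [if_pos (by simpa using hhi)]
    simp [rneShiftNat, Nat.mod_one]
  · have hn0 : n ≠ 0 := by
      intro h; subst h
      exact absurd hlo (not_le.mpr (by positivity))
    have hlog : Nat.log2 n = m + e := (Nat.log2_eq_iff hn0).mpr ⟨hlo, hhi⟩
    have hge : ¬ n < 2 ^ (m + 1) :=
      not_lt.mpr (le_trans (Nat.pow_le_pow_right (by norm_num) (by omega)) hlo)
    rw [if_neg hge, hlog, Nat.add_sub_cancel_left]

/-- `rneShiftNat` ON A DECOMPOSITION `n = q · 2^e + r`, `r < 2^e`: the quotient `q`, plus one if the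
remainder exceeds half the spacing, or equals it and `q` is odd. [cite: IEEE7542019, §4.3.1] -/
theorem rneShiftNat_of_decomp (q : ℕ) {r e : ℕ} (hr : r < 2 ^ e) :
    rneShiftNat (q * 2 ^ e + r) e =
      q + (if 2 * r < 2 ^ e then 0 else if 2 ^ e < 2 * r then 1 else q % 2) := by
  have hP : 0 < 2 ^ e := by positivity
  have h1 : (q * 2 ^ e + r) % 2 ^ e = r := by
    rw [Nat.add_comm, Nat.add_mul_mod_self_right, Nat.mod_eq_of_lt hr]
  have h2 : (q * 2 ^ e + r) / 2 ^ e = q := by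
    rw [Nat.add_comm, Nat.add_mul_div_right _ _ hP, Nat.div_eq_of_lt hr, zero_add]
  unfold rneShiftNat
  rw [h1, h2]
  split_ifs <;> omega

/-! ### The bridge to `roundNE φ` on the quarter grid -/

variable {φ : Format}

/-- Integers below `2^(m+1)` in magnitude, read in quarter units, are values of `φ` (when the quarter
grid lies in `φ`'s exponent range and the value is in range). [folklore] -/
theorem exists_toRat_eq_quarter_prec (hq : φ.qexp ≤ -2) {K : ℤ}
    (hK : K.natAbs < 2 ^ (φ.manBits + 1)) (hR : ((K.natAbs : ℕ) : ℚ) / 4 ≤ φ.maxRat) :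
    ∃ y : MiniFloat φ, y.toRat = (K : ℚ) / 4 := by
  refine exists_toRat_eq_of_isFloat ⟨K, -2, ?_, hq, ?_⟩ ?_
  · rw [← Int.natCast_natAbs]; exact_mod_cast hK
  · rw [zpow_neg, zpow_ofNat]; ring
  · rwa [abs_div, abs_of_pos (by norm_num : (0 : ℚ) < 4), ← Int.cast_abs, ← Nat.cast_natAbs]

/-- THE BRIDGE FOR EVERY PRECISION: `fl_φ(K/4) = rneZ (manBits φ) K / 4` whenever `qexp φ ≤ -2` and
`|K|/4 ≤ maxRat φ` — exact below `2^(m+1)`, the pattern rounding above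
(`Format.rneGrid_of_pattern`); no saturation occurs. [folklore] -/
theorem toRat_roundNE_quarter_prec (hq : φ.qexp ≤ -2) (K : ℤ)
    (hR : ((K.natAbs : ℕ) : ℚ) / 4 ≤ φ.maxRat) :
    (roundNE φ ((K : ℚ) / 4)).toRat = (rneZ φ.manBits K : ℚ) / 4 := by
  have habs : |(K : ℚ) / 4| = (K.natAbs : ℚ) / 4 := by
    rw [abs_div, abs_of_pos (by norm_num : (0 : ℚ) < 4), Nat.cast_natAbs, Int.cast_abs]
  have hsgn : (K : ℚ) / 4 < 0 ↔ K < 0 := by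
    rw [div_lt_iff₀ (by norm_num : (0 : ℚ) < 4), zero_mul]; norm_cast
  have hmax : |(K : ℚ) / 4| ≤ φ.maxRat := by rw [habs]; exact hR
  by_cases hn : K.natAbs < 2 ^ (φ.manBits + 1)
  · -- exact branch
    rw [toRat_roundNE_of_exists (exists_toRat_eq_quarter_prec hq hn hR)]
    unfold rneZ rneSigMag
    rw [if_pos hn]
    have : (if K < 0 then -((K.natAbs : ℕ) : ℤ) else ((K.natAbs : ℕ) : ℤ)) = K := by
      split_ifs with h <;> omega
    rw [this]
  · -- pattern branch
    have hn0 : K.natAbs ≠ 0 := by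
      intro h; rw [h] at hn; exact hn (by positivity)
    have hA : 2 ^ Nat.log2 K.natAbs ≤ K.natAbs := Nat.log2_self_le hn0
    have hB : K.natAbs < 2 ^ (Nat.log2 K.natAbs + 1) := Nat.lt_log2_self
    have hm : φ.manBits + 1 ≤ Nat.log2 K.natAbs := by
      by_contra hc
      have := Nat.pow_le_pow_right (by norm_num : 0 < 2)
        (show Nat.log2 K.natAbs + 1 ≤ φ.manBits + 1 by omega)
      omega
    set k := Nat.log2 K.natAbs - φ.manBits with hk
    have hlk : Nat.log2 K.natAbs = φ.manBits + k := by omega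
    have hlo : 2 ^ (φ.manBits + k) ≤ K.natAbs := by rw [← hlk]; exact hA
    have hhi : K.natAbs < 2 ^ (φ.manBits + k + 1) := by rw [← hlk]; exact hB
    obtain ⟨g, hg⟩ := Int.eq_ofNat_of_zero_le (show (0 : ℤ) ≤ -2 - φ.qexp by omega)
    have hq4 : (1 : ℚ) / 4 = 2 ^ g * φ.quantum := by
      unfold Format.quantum
      rw [← zpow_natCast, ← zpow_add₀ (by norm_num : (2 : ℚ) ≠ 0),
        show (g : ℤ) + φ.qexp = -2 by omega]
      norm_num
    have hx : |(K : ℚ) / 4| = (K.natAbs : ℚ) * 2 ^ (g + k) / 2 ^ k * φ.quantum := by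
      rw [habs, pow_add, div_eq_mul_one_div (K.natAbs : ℚ) 4, hq4]; field_simp
    have hgrid := Format.rneGrid_of_pattern hlo hhi (pattern_le_maxScaled hx hmax)
    rw [rneInt_natCast_div_two_pow, Int.cast_natCast] at hgrid
    rw [toRat_roundNE, scaledInput_of_pattern hx]
    unfold rneZ
    rw [rneSigMag_of_binade hlo hhi]
    simp only [hsgn]
    split_ifs with hneg
    · rw [neg_mul, hgrid]; push_cast
      rw [pow_add, div_eq_mul_one_div _ (4 : ℚ), hq4]; ring
    · rw [hgrid]; push_cast
      rw [pow_add, div_eq_mul_one_div _ (4 : ℚ), hq4]; ring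

/-- A rounded quarter-grid value is a value of `φ`. [folklore] -/
theorem exists_toRat_eq_rneZ_quarter (hq : φ.qexp ≤ -2) (K : ℤ)
    (hR : ((K.natAbs : ℕ) : ℚ) / 4 ≤ φ.maxRat) :
    ∃ y : MiniFloat φ, y.toRat = (rneZ φ.manBits K : ℚ) / 4 :=
  ⟨_, toRat_roundNE_quarter_prec hq K hR⟩

/-! ### Range bookkeeping: `|K| < 2^(m+10)` and `2^(m+8) ≤ maxRat` -/

/-- The size hypothesis of the all-precision certificates implies the range hypothesis of the bridge.
[folklore] -/
theorem quarter_le_maxRat_of_lt (hRange : (2 : ℚ) ^ (φ.manBits + 8) ≤ φ.maxRat) {K : ℤ}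
    (hK : K.natAbs < 2 ^ (φ.manBits + 10)) : ((K.natAbs : ℕ) : ℚ) / 4 ≤ φ.maxRat := by
  have h : ((K.natAbs : ℕ) : ℚ) < 2 ^ (φ.manBits + 10) := by exact_mod_cast hK
  rw [div_le_iff₀ (by norm_num : (0 : ℚ) < 4)]
  have : (2 : ℚ) ^ (φ.manBits + 10) = 2 ^ (φ.manBits + 8) * 4 := by ring
  linarith

/-! ### One step, gain and deficit in quarter units, every precision -/

/-- `fl_φ(V/4 + Q/4) = rneZ m (V + Q)/4`. [cell; the bridge] -/
theorem flStep_quarter_prec (hq : φ.qexp ≤ -2) {V Q : ℤ}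
    (h : (((V + Q).natAbs : ℕ) : ℚ) / 4 ≤ φ.maxRat) :
    flStep φ ((V : ℚ) / 4) ((Q : ℚ) / 4) = (rneZ φ.manBits (V + Q) : ℚ) / 4 := by
  unfold flStep
  rw [show (V : ℚ) / 4 + (Q : ℚ) / 4 = ((V + Q : ℤ) : ℚ) / 4 by push_cast; ring]
  exact toRat_roundNE_quarter_prec hq (V + Q) h

/-- The gain in quarter units. [cell] -/
theorem gainOf_quarter_prec (hq : φ.qexp ≤ -2) {V Q : ℤ}
    (h : (((V + Q).natAbs : ℕ) : ℚ) / 4 ≤ φ.maxRat) :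
    gainOf φ ((V : ℚ) / 4) ((Q : ℚ) / 4) = ((rneZ φ.manBits (V + Q) - V - Q : ℤ) : ℚ) / 4 := by
  unfold gainOf; rw [flStep_quarter_prec hq h]; push_cast; ring

/-- The deficit in quarter units. [cell] -/
theorem deficitOf_quarter_prec (hq : φ.qexp ≤ -2) {V Q : ℤ}
    (h : (((V + Q).natAbs : ℕ) : ℚ) / 4 ≤ φ.maxRat) :
    deficitOf φ ((V : ℚ) / 4) ((Q : ℚ) / 4)
      = (((Q.natAbs : ℤ) - (rneZ φ.manBits (V + Q) - V - Q) : ℤ) : ℚ) / 4 := by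
  unfold deficitOf
  rw [gainOf_quarter_prec hq h, abs_div, abs_of_pos (by norm_num : (0 : ℚ) < 4), ← Int.cast_abs,
    ← Int.natCast_natAbs]
  push_cast; ring

/-- Sanity values (`m = 7`, i.e. `bfloat16`'s 8 bits, spacing `8` on `[1024, 2048)`; and `m = 23`,
`binary32`): `1023 ↦ 1024`, `1027 ↦ 1024`, `1028 ↦ 1024` and `1036 ↦ 1040` (ties to even),
`-1036 ↦ -1040`; `2^24 + 1 ↦ 2^24`, `2^24 + 3 ↦ 2^24 + 4`. [cell, kernel-checked] -/
theorem rneZ_values :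
    rneZ 7 1023 = 1024 ∧ rneZ 7 1027 = 1024 ∧ rneZ 7 1028 = 1024 ∧ rneZ 7 1036 = 1040 ∧
    rneZ 7 (-1036) = -1040 ∧ rneZ 23 (2 ^ 24 + 1) = 2 ^ 24 ∧ rneZ 23 (2 ^ 24 + 3) = 2 ^ 24 + 4 := by
  decide +kernel

end MiniFloat

end Literature.ComputerArithmetic.FloatingPoint
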